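import Literature.NumberTheory.GelbartRogawski1991.LocalDoubledUnitarySiegel
import Literature.NumberTheory.GelbartRogawski1991.DoubledUnitaryAdaptedRelations
import Literature.LinearAlgebra.QuadraticForm.LagrangianTransitive
import HarnessLib

-- buildfix G11b-3 recipe (LEDGER B13-1/B13-3): elaborate sequentially so the trailing `attribute [implicit_reducible]`
-- block (reducibilityCoreExt is keyed to the async environment branch) is in force at `.olean` export.
set_option Elab.async false

/-!
# The doubled unitary group at a finite place: the Lagrangians `ℓ_Δ`, `ι(g)ℓ_Δ` and the big cell, read over
# `E ⊗ F_v` in the `Δ`-adapted frame ([Kudla1994, §3]; [HarrisKudlaSweet1996, §1 (1.11)])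

Topic `NumberTheory/GelbartRogawski1991`; namespace
`Literature.NumberTheory.GelbartRogawski1991.UnitaryDualPair.LocalSplitting` (sequel of `LocalDoubledUnitarySiegel` and
of `DoubledUnitaryAdaptedRelations`).  KERNEL only: definitions with bodies and proved lemmas; no named fact, no `sorry`.

The symplectic objects of the GR-1 local package live on `𝕎_v = F_v^{n+n} × F_v^{n+n}` (the tree's frame of the
Schrödinger model); Kudla's computation ([Kudla1994, §3]) is done over `E ⊗ F_v` in the frame adapted to
`𝔻 = Δ ⊕ Δ⁻`.  This file is the dictionary:

* §1 `matA g = reindex e₂⁻¹ e₂⁻¹ (matrix of g)` over `E ⊗ F_v` and its unitarity relation for `T₀ ⊕ (−T₀)`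
  (`cstar_matA`), so that the adapted-block calculus (`blkA`, `blkC`, `rel₁₁`, …) applies to `matA g`;
* §2 `deltaV` (the diagonal vectors) and `imDeltaV g = matA g · deltaV`, `u ∈ imDeltaV g ↔ u = dblV (A z) + adblV (C z)`,
  and `IsCompl (imDeltaV g) deltaV ↔ C(g)` invertible (`isUnit_blkC_of_isCompl`, `isCompl_of_isUnit_blkC`);
* §3 the `F_v`-LINEAR frame `eD : (Fin n ⊕ Fin n → E ⊗ F_v) ≃ₗ[F_v] 𝕎_v` (re-enumeration `e₂` followed by the
  quadratic coordinates `reIm`) with `eD (matA g · u) = ι(g) (eD u)` (`eD_matA_mulVec`), the pulled-back form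
  `formD = (alt (polar β)) ∘ (eD × eD) = im h_𝔻` (`formD_eq_im`), `deltaV.map eD = ℓ_Δ`, `(imDeltaV g).map eD = ι(g)ℓ_Δ`;
* §4 **the big cell**: `ι(g) ∈ Ω_{ℓ_Δ}` (`ι(g)ℓ_Δ ⋔ ℓ_Δ`, tree `bigCell`) iff the adapted block `C(g)` is invertible
  (`iotaD_mem_bigCell_iff_isUnit_blkC`).

Written for the kernel construction of [GelbartRogawski1991, Prop. 3.1.1] behind the cited input `hGRU` of the
Hodge-CM period-theorem package (stage-1 cell `pub-hodgecm`, seat GR-1, 2026-08-21; bricks J1/J2 of the local skeleton).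

## References

* S. S. Kudla, Israel J. Math. 87 (1994) 361–401, §3 [Kudla1994].
* M. Harris, S. S. Kudla, W. J. Sweet, J. Amer. Math. Soc. 9 (1996) 941–1004, §1 (1.11) [HarrisKudlaSweet1996].
* A. Weil, Acta Math. 111 (1964), n° 32 [Weil1964].
-/

set_option autoImplicit false

noncomputable section

open NumberField IsDedekindDomain Matrix
open Literature.RepresentationTheory.HeisenbergGroup
open Literature.NumberTheory.Automorphic Literature.NumberTheory.Automorphic.UnitaryGroup
open Literature.NumberTheory.Automorphic.UnitaryGroup.QuadraticCoordinates
open Literature.NumberTheory.GelbartRogawski1991.AdaptedBlocks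
open Literature.LinearAlgebra.QuadraticForm

namespace Literature.NumberTheory.GelbartRogawski1991.UnitaryDualPair.LocalSplitting

variable (F : Type) [Field F] [NumberField F] (E : Type) [Field E] [NumberField E] [Algebra F E]
  (c : E ≃ₐ[F] E)
  {δ : E} (hcδ : c δ = -δ) (hδ : δ ≠ 0) {d : F} (hd : δ * δ = algebraMap F E d)
  (v : HeightOneSpectrum (𝓞 F)) (n : ℕ) {T₀ : Matrix (Fin n) (Fin n) F} (hT₀ : T₀.IsSymm) (hT₀d : IsUnit T₀.det)
  {JD : Matrix (Fin (n + n)) (Fin (n + n)) E} (hJD : JD = (gramD F n T₀).map (algebraMap F E))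

/-! ## §1 The adapted matrices `matA g` and their unitarity relation -/

/-- **the adapted matrix of `g ∈ H(F_v)`**: its matrix over `E ⊗ F_v`, re-enumerated along `e₂ : Fin n ⊕ Fin n ≃ Fin (n+n)`.
[cite: Kudla1994, §3] -/
def matA (g : UnitaryGroup.localPi E c (n + n) JD v) : Matrix (Fin n ⊕ Fin n) (Fin n ⊕ Fin n) (LocalRing E v) :=
  Matrix.reindex (e₂ n).symm (e₂ n).symm (matS F E c v n g)

/-- `matS` is multiplicative. [cite: Kudla1994, §3] -/
theorem matS_mul (g h : UnitaryGroup.localPi E c (n + n) JD v) :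
    matS F E c v n (g * h) = matS F E c v n g * matS F E c v n h := by
  simp only [matS, _root_.map_mul, Subgroup.coe_mul, Units.val_mul]

/-- `matS 1 = 1`. [cite: Kudla1994, §3] -/
theorem matS_one : matS F E c v n (1 : UnitaryGroup.localPi E c (n + n) JD v) = 1 := by
  simp only [matS, _root_.map_one, Subgroup.coe_one, Units.val_one]

/-- `matA` is multiplicative. [cite: Kudla1994, §3] -/
theorem matA_mul (g h : UnitaryGroup.localPi E c (n + n) JD v) :
    matA F E c v n g * matA F E c v n h = matA F E c v n (g * h) := by
  rw [matA, matA, matA, matS_mul, Matrix.reindex_apply, Matrix.reindex_apply, Matrix.reindex_apply,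
    Matrix.submatrix_mul_equiv]

/-- `matA 1 = 1`. [cite: Kudla1994, §3] -/
theorem matA_one : matA F E c v n (1 : UnitaryGroup.localPi E c (n + n) JD v) = 1 := by
  rw [matA, matS_one, Matrix.reindex_apply, Matrix.submatrix_one_equiv]

/-- `det (matA g)` is a unit. [cite: Kudla1994, §3] -/
theorem isUnit_det_matA (g : UnitaryGroup.localPi E c (n + n) JD v) : IsUnit (matA F E c v n g).det := by
  rw [matA, Matrix.reindex_apply, Matrix.det_submatrix_equiv_self]
  exact Matrix.isUnits_det_units _

/-- `matA g · u = (matS g · (u ∘ e₂⁻¹)) ∘ e₂`. [cite: Kudla1994, §3] -/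
theorem matA_mulVec (g : UnitaryGroup.localPi E c (n + n) JD v) (u : Fin n ⊕ Fin n → (LocalRing E v)) :
    matA F E c v n g *ᵥ u = (matS F E c v n g *ᵥ (u ∘ (e₂ n).symm)) ∘ (e₂ n) := by
  rw [matA, Matrix.reindex_apply, Matrix.submatrix_mulVec_equiv]
  rfl

/-- the local Gram matrix `T₀ ⊗ 1 ∈ M_n(E ⊗ F_v)`. [cite: HarrisKudlaSweet1996, §1 (1.9)] -/
abbrev gramS (T₀ : Matrix (Fin n) (Fin n) F) : Matrix (Fin n) (Fin n) (LocalRing E v) := (T₀.map (algebraMap F (v.adicCompletion F))).map (toLocalRing E v)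

include hJD in
/-- the local form matrix of the doubled datum is `e₂`-reindexed `T₀ ⊕ (−T₀)` over `E ⊗ F_v`.
[cite: HarrisKudlaSweet1996, §1 (1.9)] -/
theorem localFormD_eq :
    (adelicForm E (n + n) JD).map (adeleToLocal E v) =
      Matrix.reindex (e₂ n) (e₂ n) (Matrix.fromBlocks (gramS F E v n T₀) 0 0 (-(gramS F E v n T₀))) := by
  rw [localForm_eq_map E (n + n) v (gramD F n T₀) hJD]
  ext i j
  simp only [gramD, Matrix.map_apply, Matrix.reindex_apply, Matrix.submatrix_apply]
  rcases (e₂ n).symm i with a | a <;> rcases (e₂ n).symm j with b | b <;>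
    simp [Matrix.fromBlocks, map_neg, map_zero]

include hJD in
/-- **the unitarity relation of `matA g`** for `T₀ ⊕ (−T₀)` over `E ⊗ F_v` (so that `rel₁₁`, `rel₁₂`, `rels_inv` of
`DoubledUnitaryAdaptedRelations` apply to `matA g`). [cite: Kudla1994, §3] -/
theorem cstar_matA (g : UnitaryGroup.localPi E c (n + n) JD v) :
    ((matA F E c v n g).map (conjLocal E c v))ᵀ *
        Matrix.fromBlocks (gramS F E v n T₀) 0 0 (-(gramS F E v n T₀)) * matA F E c v n g =
      Matrix.fromBlocks (gramS F E v n T₀) 0 0 (-(gramS F E v n T₀)) := by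
  have hg := mem_unitaryGroupOfForm_iff.1 (localPiEquiv E c (n + n) JD v g).2
  rw [localFormD_eq F E v n hJD] at hg
  -- `hg` is the relation for `matS g`; re-enumerate by `e₂`
  have hJ' : Matrix.fromBlocks (gramS F E v n T₀) 0 0 (-(gramS F E v n T₀)) =
      (Matrix.reindex (e₂ n) (e₂ n) (Matrix.fromBlocks (gramS F E v n T₀) 0 0 (-(gramS F E v n T₀)))).submatrix
        (e₂ n) (e₂ n) := by
    rw [Matrix.reindex_apply, Matrix.submatrix_submatrix, Equiv.symm_comp_self, Matrix.submatrix_id_id]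
  have hM : matA F E c v n g = (matS F E c v n g).submatrix (e₂ n) (e₂ n) := by
    rw [matA, Matrix.reindex_apply, Equiv.symm_symm]
  have hMt : ((matA F E c v n g).map (conjLocal E c v))ᵀ = ((matS F E c v n g).map (conjLocal E c v))ᵀ.submatrix (e₂ n) (e₂ n) := by
    rw [hM, ← Matrix.submatrix_map, Matrix.transpose_submatrix]
  rw [hMt, hM, hJ', Matrix.submatrix_mul_equiv, Matrix.submatrix_mul_equiv]
  exact congrArg (fun X => X.submatrix (e₂ n) (e₂ n)) hg

/-- re-enumeration of the hermitian form: `h_{reindex e e J}(u ∘ e⁻¹, u' ∘ e⁻¹) = h_J(u, u')`.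
[cite: HarrisKudlaSweet1996, §1 (1.9)] -/
theorem hermForm_reindex {R : Type*} [CommRing R] {ι m : Type*} [Fintype ι] [Fintype m] (e : ι ≃ m) (σ : R →+* R)
    (J : Matrix ι ι R) (u u' : ι → R) :
    hermForm σ (Matrix.reindex e e J) (u ∘ e.symm) (u' ∘ e.symm) = hermForm σ J u u' := by
  rw [hermForm_apply, hermForm_apply, Matrix.reindex_apply, Matrix.submatrix_mulVec_equiv]
  have : (u' ∘ ⇑e.symm) ∘ ⇑e.symm.symm = u' := by
    funext i; simp only [Function.comp_apply, Equiv.symm_symm, Equiv.symm_apply_apply]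
  rw [this, ← Function.comp_assoc, comp_equiv_symm_dotProduct]
  congr 1
  funext i
  simp only [Function.comp_apply, Equiv.symm_apply_apply]

/-! ## §2 `Δ` and `g·Δ` over `E ⊗ F_v`; `g·Δ ⋔ Δ ↔ C(g)` invertible -/

/-- the diagonal vectors `Δ ⊗ F_v = {dblV a}` as an `F_v`-subspace of `(E ⊗ F_v)^{n ⊕ n}`. [cite: HarrisKudlaSweet1996, §1 (1.11)] -/
def deltaV : Submodule (v.adicCompletion F) (Fin n ⊕ Fin n → (LocalRing E v)) where
  carrier := {u | ∀ i : Fin n, u (Sum.inl i) = u (Sum.inr i)}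
  add_mem' := by
    intro u u' hu hu' i
    simp only [Pi.add_apply, hu i, hu' i]
  zero_mem' := fun _ => rfl
  smul_mem' := by
    intro t u hu i
    simp only [Pi.smul_apply, hu i]

/-- membership in `deltaV`. [cite: HarrisKudlaSweet1996, §1 (1.11)] -/
theorem mem_deltaV_iff (u : Fin n ⊕ Fin n → (LocalRing E v)) : u ∈ deltaV F E v n ↔ ∀ i : Fin n, u (Sum.inl i) = u (Sum.inr i) :=
  Iff.rfl

/-- `dblV a ∈ deltaV`. [cite: HarrisKudlaSweet1996, §1 (1.11)] -/
theorem dblV_mem_deltaV (a : Fin n → (LocalRing E v)) : dblV a ∈ deltaV F E v n := fun i => by simp [dblV]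

/-- `u ∈ deltaV ↔ u = dblV a` for some `a`. [cite: HarrisKudlaSweet1996, §1 (1.11)] -/
theorem mem_deltaV_iff_exists (u : Fin n ⊕ Fin n → (LocalRing E v)) : u ∈ deltaV F E v n ↔ ∃ a : Fin n → (LocalRing E v), u = dblV a := by
  constructor
  · intro hu
    refine ⟨u ∘ Sum.inl, funext fun k => ?_⟩
    rcases k with i | i
    · simp [dblV]
    · simp [dblV, hu i]
  · rintro ⟨a, rfl⟩
    exact dblV_mem_deltaV F E v n a

/-- `2` is invertible in `E ⊗ F_v` (characteristic `0`). [cite: HarrisKudlaSweet1996, §1 (1.11)] -/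
instance invertibleTwoLocalRing : Invertible (2 : (LocalRing E v)) := by
  haveI : CharZero (v.adicCompletion F) := charZero_of_injective_algebraMap (algebraMap F (v.adicCompletion F)).injective
  haveI : Invertible (2 : (v.adicCompletion F)) := invertibleOfNonzero two_ne_zero
  exact (Invertible.map (algebraMap (v.adicCompletion F) (LocalRing E v)) 2).copy 2 (map_ofNat _ 2).symm

/-- `dblV a + adblV b ∈ deltaV ↔ b = 0`. [cite: HarrisKudlaSweet1996, §1 (1.11)] -/
theorem dblV_add_adblV_mem_deltaV_iff (a b : Fin n → (LocalRing E v)) : dblV a + adblV b ∈ deltaV F E v n ↔ b = 0 := by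
  rw [mem_deltaV_iff_exists]
  constructor
  · rintro ⟨a', h⟩
    exact (dblV_add_adblV_inj (a := a) (b := b) (a' := a') (b' := 0) (by simpa using h)).2
  · rintro rfl
    exact ⟨a, by simp⟩

/-- **`g·Δ` in the adapted frame**: `imDeltaV g = matA g · deltaV`. [cite: Kudla1994, §3] -/
def imDeltaV (g : UnitaryGroup.localPi E c (n + n) JD v) : Submodule (v.adicCompletion F) (Fin n ⊕ Fin n → (LocalRing E v)) :=
  (deltaV F E v n).map ((Matrix.toLin' (matA F E c v n g)).restrictScalars (v.adicCompletion F))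

/-- **membership in `imDeltaV g`**: `u = dblV (A z) + adblV (C z)` for the adapted blocks `A = blkA (matA g)`,
`C = blkC (matA g)`. [cite: Kudla1994, §3] -/
theorem mem_imDeltaV_iff (g : UnitaryGroup.localPi E c (n + n) JD v) (u : Fin n ⊕ Fin n → (LocalRing E v)) :
    u ∈ imDeltaV F E c v n g ↔
      ∃ z : Fin n → (LocalRing E v), u = dblV (blkA (matA F E c v n g) *ᵥ z) + adblV (blkC (matA F E c v n g) *ᵥ z) := by
  rw [imDeltaV, Submodule.mem_map]
  constructor
  · rintro ⟨w, hw, rfl⟩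
    obtain ⟨z, rfl⟩ := (mem_deltaV_iff_exists F E v n w).1 hw
    exact ⟨z, by rw [LinearMap.restrictScalars_apply, Matrix.toLin'_apply, mulVec_dblV]⟩
  · rintro ⟨z, rfl⟩
    exact ⟨dblV z, dblV_mem_deltaV F E v n z, by rw [LinearMap.restrictScalars_apply, Matrix.toLin'_apply, mulVec_dblV]⟩

/-- **`g·Δ ⋔ Δ ⇒ C(g)` invertible**: the `Δ → Δ⁻` block of `g` is surjective, hence a unit. [cite: Kudla1994, §3] -/
theorem isUnit_blkC_of_isCompl {g : UnitaryGroup.localPi E c (n + n) JD v}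
    (h : IsCompl (imDeltaV F E c v n g) (deltaV F E v n)) : IsUnit (blkC (matA F E c v n g)) := by
  rw [← Matrix.mulVec_surjective_iff_isUnit]
  intro y
  have htop : adblV y ∈ imDeltaV F E c v n g ⊔ deltaV F E v n := by rw [h.sup_eq_top]; exact Submodule.mem_top
  obtain ⟨u, hu, w, hw, huw⟩ := Submodule.mem_sup.1 htop
  obtain ⟨z, rfl⟩ := (mem_imDeltaV_iff F E c v n g u).1 hu
  obtain ⟨a, rfl⟩ := (mem_deltaV_iff_exists F E v n w).1 hw
  refine ⟨z, ?_⟩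
  have key := congrArg halfDiff huw
  rw [halfDiff_add, halfDiff_dblV_add_adblV, halfDiff_dblV, add_zero, halfDiff_adblV] at key
  exact key

/-- **`C(g)` invertible `⇒ g·Δ ⋔ Δ`**: `(dblV (A z) + adblV (C z)) + dblV a` exhausts `Δ ⊕ Δ⁻` and meets `Δ` trivially.
[cite: Kudla1994, §3] -/
theorem isCompl_of_isUnit_blkC {g : UnitaryGroup.localPi E c (n + n) JD v}
    (h : IsUnit (blkC (matA F E c v n g))) : IsCompl (imDeltaV F E c v n g) (deltaV F E v n) := by
  obtain ⟨Cinv, hCCinv, hCinvC⟩ := isUnit_iff_exists.1 h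
  refine IsCompl.of_eq ?_ ?_
  · rw [Submodule.eq_bot_iff]
    intro u hu
    obtain ⟨hu₁, hu₂⟩ := Submodule.mem_inf.1 hu
    obtain ⟨z, rfl⟩ := (mem_imDeltaV_iff F E c v n g u).1 hu₁
    have hz : blkC (matA F E c v n g) *ᵥ z = 0 := (dblV_add_adblV_mem_deltaV_iff F E v n _ _).1 hu₂
    have hz0 : z = 0 := by
      have := congrArg (Cinv *ᵥ ·) hz
      simpa only [Matrix.mulVec_mulVec, hCinvC, Matrix.one_mulVec, Matrix.mulVec_zero] using this
    rw [hz0, Matrix.mulVec_zero, Matrix.mulVec_zero, dblV_zero, adblV_zero, add_zero]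
  · rw [Submodule.eq_top_iff']
    intro u
    set z := Cinv *ᵥ halfDiff u with hz
    have hCz : blkC (matA F E c v n g) *ᵥ z = halfDiff u := by
      rw [hz, Matrix.mulVec_mulVec, hCCinv, Matrix.one_mulVec]
    have hu : u = (dblV (blkA (matA F E c v n g) *ᵥ z) + adblV (blkC (matA F E c v n g) *ᵥ z)) +
        dblV (halfSum u - blkA (matA F E c v n g) *ᵥ z) := by
      rw [hCz, add_right_comm, ← dblV_add, add_sub_cancel, dblV_halfSum_add_adblV_halfDiff]
    rw [hu]
    exact Submodule.add_mem_sup ((mem_imDeltaV_iff F E c v n g _).2 ⟨z, rfl⟩) (dblV_mem_deltaV F E v n _)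

/-! ## §3 The `F_v`-linear frame `eD` and the pulled-back form -/

section Frame

variable [Algebra.IsQuadraticExtension F E]

/-- the quadratic coordinates `reIm : (E ⊗ F_v)^N ≃ F_v^N × F_v^N` as an `F_v`-LINEAR equivalence
(`re (ι_v t · z) = t · re z`). [cite: HarrisKudlaSweet1996, §1 (1.11)] -/
def reImL (N : ℕ) : (Fin N → (LocalRing E v)) ≃ₗ[(v.adicCompletion F)] ((Fin N → (v.adicCompletion F)) × (Fin N → (v.adicCompletion F))) :=
  { QuadraticCoordinates.reIm (quadraticLocalEquiv E v c hcδ hδ).toLinearEquiv.toAddEquiv (Fin N) with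
    map_smul' := fun t x => by
      have h := isQuadraticCoordinates_local E v c hcδ hδ hd
      change QuadraticCoordinates.reIm _ (Fin N) (t • x) = t • QuadraticCoordinates.reIm _ (Fin N) x
      refine Prod.ext (funext fun i => ?_) (funext fun i => ?_) <;>
        simp only [reIm_apply_fst, reIm_apply_snd, Prod.smul_fst, Prod.smul_snd, Pi.smul_apply, smul_localRing_def,
          h.re_map_mul, h.im_map_mul, smul_eq_mul] }

/-- `reImL` is `localReImD` on elements. [cite: HarrisKudlaSweet1996, §1 (1.11)] -/
@[simp] theorem reImL_apply (x : Fin (n + n) → (LocalRing E v)) :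
    reImL F E c hcδ hδ hd v (n + n) x = localReImD F E c hcδ hδ v n x := rfl

/-- **the frame**: `eD u = reIm (u ∘ e₂⁻¹)`, an `F_v`-linear equivalence from the `(Fin n ⊕ Fin n)`-indexed vectors over
`E ⊗ F_v` to `𝕎_v`. [cite: HarrisKudlaSweet1996, §1 (1.11)] -/
def eD : (Fin n ⊕ Fin n → (LocalRing E v)) ≃ₗ[(v.adicCompletion F)] ((Fin (n + n) → (v.adicCompletion F)) × (Fin (n + n) → (v.adicCompletion F))) :=
  (LinearEquiv.funCongrLeft (v.adicCompletion F) (LocalRing E v) (e₂ n)).symm ≪≫ₗ reImL F E c hcδ hδ hd v (n + n)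

/-- `eD u = reIm (u ∘ e₂⁻¹)`. [cite: HarrisKudlaSweet1996, §1 (1.11)] -/
theorem eD_apply (u : Fin n ⊕ Fin n → (LocalRing E v)) :
    eD F E c hcδ hδ hd v n u = localReImD F E c hcδ hδ v n (u ∘ (e₂ n).symm) := by
  rw [eD, LinearEquiv.trans_apply, LinearEquiv.funCongrLeft_symm, LinearEquiv.funCongrLeft_apply]
  rfl

include hT₀ hJD in
/-- **`eD (matA g · u) = ι(g) (eD u)`**: in the frame `eD` the symplectic action of `g` is its matrix action.
[cite: Kudla1994, §3] -/
theorem eD_matA_mulVec (g : UnitaryGroup.localPi E c (n + n) JD v) (u : Fin n ⊕ Fin n → (LocalRing E v)) :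
    eD F E c hcδ hδ hd v n (matA F E c v n g *ᵥ u) =
      toLin F v (iotaD F E c hcδ hδ hd v n hT₀ hJD g) (eD F E c hcδ hδ hd v n u) := by
  rw [eD_apply, eD_apply, iotaD_localReIm F E c hcδ hδ hd v n hT₀ hJD, matA_mulVec]
  congr 1
  funext k
  simp only [Function.comp_apply, Equiv.apply_symm_apply]

/-- `eD ∘ (matA g ·) = ι(g) ∘ eD` as `F_v`-linear maps. [cite: Kudla1994, §3] -/
theorem eD_comp_matA (g : UnitaryGroup.localPi E c (n + n) JD v) :
    (eD F E c hcδ hδ hd v n : (Fin n ⊕ Fin n → (LocalRing E v)) →ₗ[(v.adicCompletion F)] _) ∘ₗ ((Matrix.toLin' (matA F E c v n g)).restrictScalars (v.adicCompletion F)) =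
      toLin F v (iotaD F E c hcδ hδ hd v n hT₀ hJD g) ∘ₗ (eD F E c hcδ hδ hd v n : (Fin n ⊕ Fin n → (LocalRing E v)) →ₗ[(v.adicCompletion F)] _) := by
  refine LinearMap.ext fun u => ?_
  simp only [LinearMap.comp_apply, LinearMap.restrictScalars_apply, Matrix.toLin'_apply, LinearEquiv.coe_coe]
  exact eD_matA_mulVec F E c hcδ hδ hd v n hT₀ hJD g u

/-- the symplectic form of `𝕎_v` pulled back to the adapted frame: `formD u u' = A(eD u, eD u')`.
[cite: HarrisKudlaSweet1996, §1 (1.9)] -/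
def formD (T₀ : Matrix (Fin n) (Fin n) F) : LinearMap.BilinForm (v.adicCompletion F) (Fin n ⊕ Fin n → (LocalRing E v)) :=
  (alt (polar (localPairing F (n + n) (gramD F n T₀) v))).compl₁₂
    (eD F E c hcδ hδ hd v n : (Fin n ⊕ Fin n → (LocalRing E v)) →ₗ[(v.adicCompletion F)] _) (eD F E c hcδ hδ hd v n : (Fin n ⊕ Fin n → (LocalRing E v)) →ₗ[(v.adicCompletion F)] _)

/-- unfolding. [cite: HarrisKudlaSweet1996, §1 (1.9)] -/
theorem formD_apply (u u' : Fin n ⊕ Fin n → (LocalRing E v)) :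
    formD F E c hcδ hδ hd v n T₀ u u' =
      alt (polar (localPairing F (n + n) (gramD F n T₀) v)) (eD F E c hcδ hδ hd v n u) (eD F E c hcδ hδ hd v n u') :=
  rfl

/-- `formD` is alternating. [cite: HarrisKudlaSweet1996, §1 (1.9)] -/
theorem isAlt_formD : LinearMap.IsAlt (formD F E c hcδ hδ hd v n T₀) :=
  fun _ => isAlt_alt_polar F (n + n) (gramD F n T₀) v _

include hT₀ hJD in
/-- **`formD = im h_𝔻`**: `A(eD u, eD u') = im h(u, u')` for the hermitian form `h = hermForm (c ⊗ 1) (T₀ ⊕ −T₀)` over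
`E ⊗ F_v` (tree `im_hermForm_map`). [cite: GelbartRogawski1991, §3.1 p. 454; HarrisKudlaSweet1996, §1 (1.9)] -/
theorem formD_eq_im (u u' : Fin n ⊕ Fin n → (LocalRing E v)) :
    formD F E c hcδ hδ hd v n T₀ u u' =
      im (quadraticLocalEquiv E v c hcδ hδ).toLinearEquiv.toAddEquiv
        (hermForm (conjLocal E c v) (Matrix.fromBlocks (gramS F E v n T₀) 0 0 (-(gramS F E v n T₀))) u u') := by
  have h := isQuadraticCoordinates_local E v c hcδ hδ hd
  have him := h.im_hermForm_map (Fin (n + n)) ((gramD_isSymm F n hT₀).map (algebraMap F (v.adicCompletion F)))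
    (σ := conjLocal E c v) (conjLocal_toLocalRing c v) (by rw [conjLocal_algebraMap, hcδ, map_neg])
    (u ∘ (e₂ n).symm) (u' ∘ (e₂ n).symm)
  rw [formD_apply, eD_apply, eD_apply, localReImD, ← him, ← localForm_eq_map E (n + n) v (gramD F n T₀) hJD,
    localFormD_eq F E v n hJD, hermForm_reindex]

include hT₀ hJD in
/-- `formD` on diagonal ∕ anti-diagonal vectors: `im (2 (aᴴ T b' + bᴴ T a'))`. [cite: HarrisKudlaSweet1996, §1 (1.11)] -/
theorem formD_dblV_adblV (a b a' b' : Fin n → (LocalRing E v)) :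
    formD F E c hcδ hδ hd v n T₀ (dblV a + adblV b) (dblV a' + adblV b') =
      im (quadraticLocalEquiv E v c hcδ hδ).toLinearEquiv.toAddEquiv
        (2 * ((⇑(conjLocal E c v) ∘ a) ⬝ᵥ (gramS F E v n T₀ *ᵥ b') +
          (⇑(conjLocal E c v) ∘ b) ⬝ᵥ (gramS F E v n T₀ *ᵥ a'))) := by
  rw [formD_eq_im F E c hcδ hδ hd v n hT₀ hJD, hermForm_dblV_adblV]

include hT₀ hJD in
/-- `deltaV`-vectors are `formD`-isotropic: `A(eD (dblV a), eD (dblV a')) = 0`. [cite: HarrisKudlaSweet1996, §1 (1.11)] -/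
theorem formD_dblV_dblV (a a' : Fin n → (LocalRing E v)) : formD F E c hcδ hδ hd v n T₀ (dblV a) (dblV a') = 0 := by
  rw [formD_eq_im F E c hcδ hδ hd v n hT₀ hJD, hermForm_dblV_dblV, map_zero]

/-- **`deltaV.map eD = ℓ_Δ`**: the tree's Lagrangian `deltaLagrangian` is the image of the diagonal vectors.
[cite: HarrisKudlaSweet1996, §1 (1.11)] -/
theorem map_eD_deltaV :
    (deltaV F E v n).map (eD F E c hcδ hδ hd v n : (Fin n ⊕ Fin n → (LocalRing E v)) →ₗ[(v.adicCompletion F)] _) = deltaLagrangian F v n := by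
  ext p
  constructor
  · rintro ⟨u, hu, rfl⟩
    rw [LinearEquiv.coe_coe, eD_apply, localReIm_mem_deltaLagrangian_iff]
    intro i
    simp only [Function.comp_apply, Equiv.symm_apply_apply]
    exact hu i
  · intro hp
    obtain ⟨x, rfl⟩ : ∃ x, p = localReImD F E c hcδ hδ v n x :=
      ⟨(localReImD F E c hcδ hδ v n).symm p, (AddEquiv.apply_symm_apply _ p).symm⟩
    rw [localReIm_mem_deltaLagrangian_iff] at hp
    refine ⟨x ∘ (e₂ n), fun i => hp i, ?_⟩
    rw [LinearEquiv.coe_coe, eD_apply]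
    congr 1
    funext k
    simp only [Function.comp_apply, Equiv.apply_symm_apply]

include hT₀ in
/-- **`(imDeltaV g).map eD = ι(g) ℓ_Δ`**. [cite: Kudla1994, §3] -/
theorem map_eD_imDeltaV (g : UnitaryGroup.localPi E c (n + n) JD v) :
    (imDeltaV F E c v n g).map (eD F E c hcδ hδ hd v n : (Fin n ⊕ Fin n → (LocalRing E v)) →ₗ[(v.adicCompletion F)] _) =
      (deltaLagrangian F v n).map (toLin F v (iotaD F E c hcδ hδ hd v n hT₀ hJD g)) := by
  rw [imDeltaV, ← Submodule.map_comp, eD_comp_matA F E c hcδ hδ hd v n hT₀ hJD g, Submodule.map_comp, map_eD_deltaV]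

/-! ## §4 The big cell: `ι(g)ℓ_Δ ⋔ ℓ_Δ ↔ C(g)` invertible -/

include hT₀ in
/-- `ι(g) ∈ Ω_{ℓ_Δ} ↔ IsCompl (imDeltaV g) deltaV` (transport of `IsCompl` along the frame `eD`). [cite: Kudla1994, §3] -/
theorem iotaD_mem_bigCell_iff_isCompl (g : UnitaryGroup.localPi E c (n + n) JD v) :
    iotaD F E c hcδ hδ hd v n hT₀ hJD g ∈
        bigCell (alt (polar (localPairing F (n + n) (gramD F n T₀) v))) (deltaLagrangian F v n) ↔
      IsCompl (imDeltaV F E c v n g) (deltaV F E v n) := by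
  change IsCompl ((deltaLagrangian F v n).map (toLin F v (iotaD F E c hcδ hδ hd v n hT₀ hJD g)))
    (deltaLagrangian F v n) ↔ _
  rw [(Submodule.orderIsoMapComap (eD F E c hcδ hδ hd v n)).isCompl_iff,
    Submodule.orderIsoMapComap_apply, Submodule.orderIsoMapComap_apply,
    map_eD_imDeltaV F E c hcδ hδ hd v n hT₀ hJD, map_eD_deltaV]

include hT₀ in
/-- **THE BIG CELL IN ADAPTED BLOCKS**: `ι(g) ∈ Ω_{ℓ_Δ}` (i.e. `ι(g)ℓ_Δ ⋔ ℓ_Δ`) iff the `Δ → Δ⁻` block `C(g)` of `g` is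
invertible (`Ω_H = P_Δ w P_Δ = {C invertible}`). [cite: Kudla1994, §3; Weil1964, n° 32] -/
theorem iotaD_mem_bigCell_iff_isUnit_blkC (g : UnitaryGroup.localPi E c (n + n) JD v) :
    iotaD F E c hcδ hδ hd v n hT₀ hJD g ∈
        bigCell (alt (polar (localPairing F (n + n) (gramD F n T₀) v))) (deltaLagrangian F v n) ↔
      IsUnit (blkC (matA F E c v n g)) := by
  rw [iotaD_mem_bigCell_iff_isCompl F E c hcδ hδ hd v n hT₀ hJD]
  exact ⟨isUnit_blkC_of_isCompl F E c v n, isCompl_of_isUnit_blkC F E c v n⟩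

end Frame

/-! ### Build-lane note (ops-buildfix G11b-3 recipe, LEDGER B13-1, 2026-08-21)
`lean -o` (the hub build lane, never `lean`/the gate check) runs Lean 4.32's library-suggestion indexers
(`Lean.LibrarySuggestions.SymbolFrequency` / `SineQuaNon`, from their `exportEntriesFn`) over the statement of
every local theorem that is not a denied premise; on this family's statements (very large dependent binder
telescopes through the theta-kernel / dual-pair data) that fold runs for tens of minutes to hours and the build
lane kills the job (incident G11b-3, run/shared/lean/ops/buildfix/G11b-3-DOSSIER.md). `isDeniedPremise` skips
`[implicit_reducible]` constants before any fold, and a reducibility status on a *theorem* is inert (Meta never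
unfolds `thmInfo`; the kernel ignores the attribute), so the public theorems of this file are tagged
`[implicit_reducible]` purely to keep them out of that index. Only other effect: they are not offered by
`+suggestions` premise selectors. No statement or proof is changed; superseded if the operator lands a
deny-list form (`HarnessLib.PremiseIndex`). -/
set_option allowUnsafeReducibility true in
attribute [implicit_reducible]
  matS_mul matS_one matA_mul matA_one isUnit_det_matA matA_mulVec localFormD_eq cstar_matA
  hermForm_reindex mem_deltaV_iff dblV_mem_deltaV mem_deltaV_iff_exists
  dblV_add_adblV_mem_deltaV_iff mem_imDeltaV_iff isUnit_blkC_of_isCompl isCompl_of_isUnit_blkC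
  reImL_apply eD_apply eD_matA_mulVec eD_comp_matA formD_apply isAlt_formD formD_eq_im
  formD_dblV_adblV formD_dblV_dblV map_eD_deltaV map_eD_imDeltaV iotaD_mem_bigCell_iff_isCompl
  iotaD_mem_bigCell_iff_isUnit_blkC

end Literature.NumberTheory.GelbartRogawski1991.UnitaryDualPair.LocalSplitting

end
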